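import Literature.Analysis.OperatorTheory.Enflo2023.Pipeline
import Literature.Analysis.OperatorTheory.Enflo2023.PolyCompactCase
import Literature.Analysis.OperatorTheory.Enflo2023.Vy
import HarnessLib

/-!
# Enflo 2023, Part B: the type-1 branch over the paper's own `ℓ²`, and the pp.1–2 WLOG reductions

Source under adjudication: Per H. Enflo, *On the invariant subspace problem in Hilbert spaces*, arXiv:2305.15442 (v1
2023, v2 2024), bib key `Enflo2023` — a CLAIMED proof of the invariant subspace problem for operators on a separable
Hilbert space.  This file is part of the kernel-tight typing of the manuscript by the b2b-enflo repair cell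
(formaliser 2, Part B: (28)–(47), the limiting argument and the final deduction).  It records what FOLLOWS (proved
implications from the manuscript's displayed hypotheses) and, where a step does not follow, the typed inference
together with its refutation.  NOTHING here asserts that the manuscript's main theorem holds; no declaration concludes
the invariant subspace problem for an arbitrary operator.  Value (BLOCK-2b): theorems / refutations of typed
inferences about a text — not progress on the problem.

Contents.  (1) The WLOG reductions of v2 pp.1–2 (tex:L61: "since the spectrum of `T`, `σ(T)`, is non-empty and
`λI + μT`, `μ ≠ 0`, has the same closed invariant subspaces as `T`, we can (without loss of generality) assume … `0 ∈ σ(T)`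
… we put `‖T‖_op = 10⁻²⁰` below") as theorems: `hasNontrivialClosedInvariantSubspace_affine_iff`,
`wlog_zero_mem_spectrum`, `hasNontrivialClosedInvariantSubspace_smul_iff`, `wlog_opNorm` (the other WLOGs — injective,
dense range, separable, `dim = ∞`, no eigenvector, adjoint — are `Reductions.lean`).  (2) The type-1 theorem of
`Pipeline.lean` (`hasNontrivialClosedInvariantSubspace_of_minimal_sequence`, stated over an abstract coefficient space
`E` with isometric intertwiner `S`) INSTANTIATED at the manuscript's own data: `E = ℓ²(ℕ, ℂ)` (`Vy.ℓ2`), `V n = V_{y'_n}`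
(`Vy.V`, formaliser 1's Part A module `Vy`: `V_y a = Σ_j a_j T^j y` for `‖T‖ < 1`), `S` = the right shift (`Vy.S`,
`Vy.norm_S_le`, `Vy.V_shift : V_y (S b) = T (V_y b)`).  Result: for `‖T‖ < 1` (WLOG by (1)), `‖x₀‖ = 1`, vectors `y'_n`,
radii `ε_n ∈ [0.3, 0.7]` and THE norm-minimal `ℓ'_n ∈ ℓ²` of problem (1) for each `n` (`IsMinimal`), the two displayed
inputs `(εθ)_n → 0` (Main Construction; rests on (27)/(33)) and NORM convergence of `ℓ'_n(T) y'_n` (the room claim of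
p.20 — refuted as an inference: `not_roomClaim`, `not_roomClaimFin`) give (11), a non-trivial closed invariant subspace
(`hasNontrivialClosedInvariantSubspace_of_minimal_vectors`); variants with rooms `ρ_k → 0` instead of convergence
(`…_rooms`), and with NO convergence input at all when some `p(T) ≠ 0`-polynomial is compact (`…_polyCompact`,
census R12, `PolyCompactCase.lean`) or `T` is compact (`…_compact`, census R8).  So the kernel holds the manuscript's
type-1 statement end to end over `ℓ²` GIVEN exactly the bracketed inputs, and refuses the norm-convergence input as an
inference from the text; nothing of the type-1 branch is left in prose.  Addendum (same day, folded in from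
formaliser 1 gen-2's withdrawn draft of this module): the data hypotheses are DISCHARGEABLE — minimal moves of problem (1)
for `V_{y'}` exist as soon as `‖x₀ − y'‖ ≤ ε` (`Vy.exists_isMinimal_of_norm_sub_le`, `Vy.exists_isMinimal_of_feasible`;
Hilbert projection in the complete `ℓ²`), (9) holds on the paper's objects with nothing abstract
(`Vy.norm_inner_pow_le_etheta`), and the summable-steps (census R3) and arbitrary-norm forms are recorded
(`…_of_minimal_vectors_summable`, `…_of_minimal_vectors_smul`).

Origin: planner-b2b-enflo-2-g2-0 (formaliser 2, gen 2), 2026-08-18.  Imports: cell modules `Pipeline` (F2/referee),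
`PolyCompactCase` (F2), `Vy` (F1); Mathlib (`spectrum.nonempty`, Gelfand).
-/

open scoped InnerProductSpace
open Filter Topology Polynomial

namespace Literature.Analysis.OperatorTheory.Enflo2023

section scaling
variable {H : Type*} [NormedAddCommGroup H] [InnerProductSpace ℂ H]

/-! ### WLOG `‖T‖_op = 10⁻²⁰` (v2 pp.1–2, tex:L61 "we put `‖T‖_op = 10⁻²⁰` below"; restated in the standing assumptions at tex:L221): invariant subspaces are unchanged by non-zero scaling -/

/-- A subspace is invariant under `c • T` (`c ≠ 0`) iff it is invariant under `T`. [folklore] -/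
lemma isInvariant_smul_iff (T : H →L[ℂ] H) {c : ℂ} (hc : c ≠ 0) (M : Submodule ℂ H) :
    IsInvariant (c • T) M ↔ IsInvariant T M := by
  refine ⟨fun h x hx => ?_, fun h x hx => ?_⟩
  · have h1 : c • T x ∈ M := h x hx
    exact (M.smul_mem_iff hc).mp h1
  · exact M.smul_mem c (h x hx)

/-- Hence `c • T` (`c ≠ 0`) has a non-trivial closed invariant subspace iff `T` has. [folklore] -/
theorem hasNontrivialClosedInvariantSubspace_smul_iff (T : H →L[ℂ] H) {c : ℂ} (hc : c ≠ 0) :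
    HasNontrivialClosedInvariantSubspace (c • T) ↔ HasNontrivialClosedInvariantSubspace T := by
  unfold HasNontrivialClosedInvariantSubspace
  simp only [isInvariant_smul_iff T hc]

/-- The multiple `(r/‖T‖) • T` of a non-zero operator has operator norm `r` (`r ≥ 0`). [folklore] -/
lemma opNorm_rescale (T : H →L[ℂ] H) (hT : T ≠ 0) {r : ℝ} (hr : 0 ≤ r) :
    ‖((r / ‖T‖ : ℝ) : ℂ) • T‖ = r := by
  have hn : ‖T‖ ≠ 0 := norm_ne_zero_iff.mpr hT
  rw [norm_smul, Complex.norm_real, Real.norm_eq_abs, abs_of_nonneg (div_nonneg hr (norm_nonneg _)),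
    div_mul_cancel₀ r hn]

/-- **WLOG of v2 p.1, tex:L61 ("we put `‖T‖_op = 10⁻²⁰` below"; standing assumption at tex:L221).**  For `T ≠ 0` the rescaled operator
`T' := (10⁻²⁰/‖T‖)•T` has `‖T'‖ = 10⁻²⁰ < 1` and the same closed invariant subspaces; so every statement below,
made for `‖T‖ < 1` (where `V_y : ℓ² → H` is bounded), applies to an arbitrary non-zero bounded operator.
[cite: Enflo2023, v2 p.1] -/
theorem wlog_opNorm (T : H →L[ℂ] H) (hT : T ≠ 0) :
    ‖(((1e-20 : ℝ) / ‖T‖ : ℝ) : ℂ) • T‖ = 1e-20 ∧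
      (HasNontrivialClosedInvariantSubspace ((((1e-20 : ℝ) / ‖T‖ : ℝ) : ℂ) • T) ↔
        HasNontrivialClosedInvariantSubspace T) := by
  refine ⟨opNorm_rescale T hT (by norm_num), hasNontrivialClosedInvariantSubspace_smul_iff T ?_⟩
  have hn : ‖T‖ ≠ 0 := norm_ne_zero_iff.mpr hT
  exact_mod_cast div_ne_zero (by norm_num) hn

end scaling

section affine
variable {H : Type*} [NormedAddCommGroup H] [InnerProductSpace ℂ H]

/-- A subspace is invariant under `l • 1 + m • T` (`m ≠ 0`) iff it is invariant under `T`
(v2 p.1, tex:L61: "`λI + μT`, `μ ≠ 0`, has the same closed invariant subspaces as `T`"). [cite: Enflo2023, v2 p.1] -/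
lemma isInvariant_affine_iff (T : H →L[ℂ] H) (l : ℂ) {m : ℂ} (hm : m ≠ 0) (M : Submodule ℂ H) :
    IsInvariant (l • (1 : H →L[ℂ] H) + m • T) M ↔ IsInvariant T M := by
  refine ⟨fun h x hx => ?_, fun h x hx => ?_⟩
  · have h1 : (l • (1 : H →L[ℂ] H) + m • T) x ∈ M := h x hx
    have h2 : m • T x ∈ M := by
      have h3 := M.sub_mem h1 (M.smul_mem l hx)
      simpa using h3
    exact (M.smul_mem_iff hm).mp h2
  · show (l • (1 : H →L[ℂ] H) + m • T) x ∈ M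
    simpa using M.add_mem (M.smul_mem l hx) (M.smul_mem m (h x hx))

/-- Hence `l • 1 + m • T` (`m ≠ 0`) has a non-trivial closed invariant subspace iff `T` has (v2 p.1, tex:L61).
[cite: Enflo2023, v2 p.1] -/
theorem hasNontrivialClosedInvariantSubspace_affine_iff (T : H →L[ℂ] H) (l : ℂ) {m : ℂ} (hm : m ≠ 0) :
    HasNontrivialClosedInvariantSubspace (l • (1 : H →L[ℂ] H) + m • T) ↔
      HasNontrivialClosedInvariantSubspace T := by
  unfold HasNontrivialClosedInvariantSubspace
  simp only [isInvariant_affine_iff T l hm]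

/-- **WLOG `0 ∈ σ(T)` (v2 p.1, tex:L61: "since the spectrum of `T`, `σ(T)`, is non-empty … we can assume …
`0 ∈ σ(T)`").**  Over a non-trivial complex Hilbert space pick `μ ∈ σ(T)` (Gelfand: `spectrum.nonempty`); then
`T − μ•1` has `0` in its spectrum and the same closed invariant subspaces as `T`. [cite: Enflo2023, v2 p.1] -/
theorem wlog_zero_mem_spectrum [CompleteSpace H] [Nontrivial H] (T : H →L[ℂ] H) :
    ∃ μ : ℂ, (0 : ℂ) ∈ spectrum ℂ (T - μ • (1 : H →L[ℂ] H)) ∧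
      (HasNontrivialClosedInvariantSubspace (T - μ • (1 : H →L[ℂ] H)) ↔
        HasNontrivialClosedInvariantSubspace T) := by
  haveI : Nontrivial (H →L[ℂ] H) := by
    obtain ⟨x, hx⟩ := exists_ne (0 : H)
    exact nontrivial_of_ne 1 0 (fun h => hx (by simpa using congrArg (fun S : H →L[ℂ] H => S x) h))
  obtain ⟨μ, hμ⟩ := spectrum.nonempty T
  refine ⟨μ, ?_, ?_⟩
  · rw [spectrum.mem_iff] at hμ ⊢
    have e : algebraMap ℂ (H →L[ℂ] H) 0 - (T - μ • (1 : H →L[ℂ] H)) =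
        algebraMap ℂ (H →L[ℂ] H) μ - T := by
      rw [map_zero, zero_sub, neg_sub, Algebra.algebraMap_eq_smul_one]
    rw [e]; exact hμ
  · have e : T - μ • (1 : H →L[ℂ] H) = (-μ) • (1 : H →L[ℂ] H) + (1 : ℂ) • T := by
      rw [neg_smul, one_smul, sub_eq_neg_add]
    rw [e]; exact hasNontrivialClosedInvariantSubspace_affine_iff T (-μ) one_ne_zero

end affine

/-! ### The type-1 branch over the paper's own `V_y : ℓ² → H` -/

section ell2
variable {H : Type*} [NormedAddCommGroup H] [InnerProductSpace ℂ H] [CompleteSpace H]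

/-- **The announced type-1 theorem, literally over `ℓ²`, modulo its two displayed hypotheses.**  Data as in the
manuscript: `‖T‖ < 1` (WLOG `wlog_opNorm`), `‖x₀‖ = 1`, vectors `y'_n`, radii `ε_n ∈ [0.3, 0.7]`, and for each `n`
THE norm-minimal coefficient sequence `a n = ℓ'_n ∈ ℓ²` of problem (1) for `V_{y'_n}` (Part A: `IsMinimal`,
existence `exists_isMinimal`).  Hypotheses beyond Part A: `hεθ` — the Main Construction drives
`(εθ)_n = Re⟨ℓ'_n(T)y'_n, x₀ − ℓ'_n(T)y'_n⟩ → 0` (rests on (27)/(33)); `hconv` — the outputs `ℓ'_n(T)y'_n` converge IN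
NORM (the ROOM CLAIM of p.20, refuted as an inference: `not_roomClaim`, `not_roomClaimFin`).  Conclusion: (11).
Obtained from `hasNontrivialClosedInvariantSubspace_of_minimal_sequence` with `E = ℓ²`, `V n = V_{y'_n}` (`Vy.V`),
`S` = the right shift (`Vy.S`, `Vy.norm_S_le`, `Vy.V_shift`). [cite: Enflo2023, v2 (1), (2), (9), (11), p.20] -/
theorem hasNontrivialClosedInvariantSubspace_of_minimal_vectors (T : H →L[ℂ] H) (hT : ‖T‖ < 1)
    (x₀ : H) (hx₀ : ‖x₀‖ = 1) (y : ℕ → H) (ε : ℕ → ℝ) (hε : ∀ n, (0.3 : ℝ) ≤ ε n ∧ ε n ≤ 0.7)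
    (a : ℕ → Vy.ℓ2) (hmin : ∀ n, IsMinimal (Vy.V T hT (y n)) x₀ (ε n) (a n))
    (hεθ : Tendsto (fun n => (⟪x₀ - Vy.V T hT (y n) (a n), Vy.V T hT (y n) (a n)⟫_ℂ).re) atTop (𝓝 0))
    (w : H) (hconv : Tendsto (fun n => Vy.V T hT (y n) (a n)) atTop (𝓝 w)) :
    HasNontrivialClosedInvariantSubspace T :=
  hasNontrivialClosedInvariantSubspace_of_minimal_sequence T x₀ hx₀ (fun n => Vy.V T hT (y n)) Vy.S Vy.norm_S_le
    (fun n b => Vy.V_shift T hT (y n) b) ε hε a hmin hεθ w hconv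

/-- The same with norm convergence replaced by the paper's intended mechanism, ROOMS `ρ_k → 0` for the iterates
`[ ]_n x₀ = x₀ − ℓ'_n(T)y'_n` from pivots `p k` on (v2 p.20: `δ₂^40, δ₂^400, …`) — the unproved (and, as an
inference from the text's facts, refuted) input, here a hypothesis. [cite: Enflo2023, v2 (1), (2), (9), (11), p.20] -/
theorem hasNontrivialClosedInvariantSubspace_of_minimal_vectors_rooms (T : H →L[ℂ] H) (hT : ‖T‖ < 1)
    (x₀ : H) (hx₀ : ‖x₀‖ = 1) (y : ℕ → H) (ε : ℕ → ℝ) (hε : ∀ n, (0.3 : ℝ) ≤ ε n ∧ ε n ≤ 0.7)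
    (a : ℕ → Vy.ℓ2) (hmin : ∀ n, IsMinimal (Vy.V T hT (y n)) x₀ (ε n) (a n))
    (hεθ : Tendsto (fun n => (⟪x₀ - Vy.V T hT (y n) (a n), Vy.V T hT (y n) (a n)⟫_ℂ).re) atTop (𝓝 0))
    (p : ℕ → ℕ) (ρ : ℕ → ℝ)
    (hroom : ∀ k n, p k ≤ n →
      ‖(x₀ - Vy.V T hT (y n) (a n)) - (x₀ - Vy.V T hT (y (p k)) (a (p k)))‖ ≤ ρ k)
    (hρ : Tendsto ρ atTop (𝓝 0)) :
    HasNontrivialClosedInvariantSubspace T :=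
  hasNontrivialClosedInvariantSubspace_of_minimal_sequence_rooms T x₀ hx₀ (fun n => Vy.V T hT (y n)) Vy.S
    Vy.norm_S_le (fun n b => Vy.V_shift T hT (y n) b) ε hε a hmin hεθ p ρ hroom hρ

/-- **Polynomially compact `T`, over `ℓ²`, with NO convergence hypothesis** (census R8/R12 end to end): if some
non-zero polynomial `p(T)` is compact (e.g. `T` compact, `T^m` compact, `T = μ•1 + K`), Part A's minimal vectors at
radii `ε_n ∈ [0.3, 0.7]` plus the single MC output `(εθ)_n → 0` already yield a non-trivial closed invariant subspace
— a weak limit suffices (`hasNontrivialClosedInvariantSubspace_of_polyCompact_MC`); no room claim, no injectivity, no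
dimension hypothesis.  The conclusion for this class is classical [cite: BernsteinRobinson1966] and not claimed new.
[cite: Enflo2023, v2 (1), (2), (9), (11), p.20] -/
theorem hasNontrivialClosedInvariantSubspace_of_minimal_vectors_polyCompact (T : H →L[ℂ] H) (hT : ‖T‖ < 1)
    {p : ℂ[X]} (hp : p ≠ 0) (hK : IsCompactOperator (aeval T p))
    (x₀ : H) (hx₀ : ‖x₀‖ = 1) (y : ℕ → H) (ε : ℕ → ℝ) (hε : ∀ n, (0.3 : ℝ) ≤ ε n ∧ ε n ≤ 0.7)
    (a : ℕ → Vy.ℓ2) (hmin : ∀ n, IsMinimal (Vy.V T hT (y n)) x₀ (ε n) (a n))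
    (hεθ : Tendsto (fun n => (⟪x₀ - Vy.V T hT (y n) (a n), Vy.V T hT (y n) (a n)⟫_ℂ).re) atTop (𝓝 0)) :
    HasNontrivialClosedInvariantSubspace T := by
  have hlt : ∀ n, ε n < ‖x₀‖ := fun n => by rw [hx₀]; linarith [(hε n).2]
  have hdist : ∀ n, (0.3 : ℝ) ≤ ‖x₀ - Vy.V T hT (y n) (a n)‖ ∧ ‖x₀ - Vy.V T hT (y n) (a n)‖ ≤ 0.7 :=
    fun n => by rw [(hmin n).norm_sub_eq (hlt n)]; exact hε n
  exact hasNontrivialClosedInvariantSubspace_of_polyCompact_MC T hp hK x₀ hx₀ (fun n => Vy.V T hT (y n) (a n))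
    (fun n => (⟪x₀ - Vy.V T hT (y n) (a n), Vy.V T hT (y n) (a n)⟫_ℂ).re) hdist hεθ
    (fun n j => norm_inner_pow_le_etheta (hmin n) (hlt n) Vy.S Vy.norm_S_le T (Vy.V_shift T hT (y n)) j)

/-- Special case `T` compact (census R8 over `ℓ²`; no injectivity needed, unlike
`hasNontrivialClosedInvariantSubspace_of_minimal_sequence_compact`). [cite: Enflo2023, v2 (1), (2), (9), (11), p.20] -/
theorem hasNontrivialClosedInvariantSubspace_of_minimal_vectors_compact (T : H →L[ℂ] H) (hT : ‖T‖ < 1)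
    (hK : IsCompactOperator T)
    (x₀ : H) (hx₀ : ‖x₀‖ = 1) (y : ℕ → H) (ε : ℕ → ℝ) (hε : ∀ n, (0.3 : ℝ) ≤ ε n ∧ ε n ≤ 0.7)
    (a : ℕ → Vy.ℓ2) (hmin : ∀ n, IsMinimal (Vy.V T hT (y n)) x₀ (ε n) (a n))
    (hεθ : Tendsto (fun n => (⟪x₀ - Vy.V T hT (y n) (a n), Vy.V T hT (y n) (a n)⟫_ℂ).re) atTop (𝓝 0)) :
    HasNontrivialClosedInvariantSubspace T :=
  hasNontrivialClosedInvariantSubspace_of_minimal_vectors_polyCompact T hT X_ne_zero (by simpa using hK)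
    x₀ hx₀ y ε hε a hmin hεθ

end ell2

/-! ### Dischargeable data and the remaining variants on the paper's objects
(folded in from formaliser 1 gen-2's withdrawn `PipelineL2` draft, `HOME/lean/tree-F1/…/PipelineL2_F1draft_WITHDRAWN.lean.txt`) -/

section data
variable {H : Type*} [NormedAddCommGroup H] [InnerProductSpace ℂ H] [CompleteSpace H]

/-- Problem (1) for `V_{y'}` HAS a minimal solution as soon as `‖x₀ − y'‖ ≤ ε` (`a = e₀` is feasible:
`V_{y'} e₀ = y'`; `ℓ²` is complete, so `exists_isMinimal` applies).  Hence the data hypothesis `hmin` of the `ℓ²`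
pipeline theorems is dischargeable at every step of the Main Construction. [cite: Enflo2023, v2 p.2, eq. (1)] -/
theorem Vy.exists_isMinimal_of_norm_sub_le (T : H →L[ℂ] H) (hT : ‖T‖ < 1) {x₀ y : H} {ε : ℝ}
    (h : ‖x₀ - y‖ ≤ ε) : ∃ a : Vy.ℓ2, IsMinimal (Vy.V T hT y) x₀ ε a := by
  refine exists_isMinimal (Vy.V T hT y) x₀ ε ⟨lp.single 2 0 (1 : ℂ), ?_⟩
  rw [mem_feasible, Vy.V_single, pow_zero, one_apply_eq_self]
  exact h

/-- More generally any feasible coefficient vector gives existence (e.g. `(1+δ)e₀` in (26)). [cite: Enflo2023, v2 p.2, eq. (1)] -/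
theorem Vy.exists_isMinimal_of_feasible (T : H →L[ℂ] H) (hT : ‖T‖ < 1) {x₀ y : H} {ε : ℝ} {b : Vy.ℓ2}
    (h : ‖x₀ - Vy.V T hT y b‖ ≤ ε) : ∃ a : Vy.ℓ2, IsMinimal (Vy.V T hT y) x₀ ε a :=
  exists_isMinimal (Vy.V T hT y) x₀ ε ⟨b, h⟩

/-- **(9) on the paper's objects**: at a minimal move `a` of `V_{y'}` at radius `ε < ‖x₀‖`,
`|⟨x₀ − V_{y'}a, T^j V_{y'}a⟩| ≤ εθ = Re⟨x₀ − V_{y'}a, V_{y'}a⟩` for all `j` — Part A's `norm_inner_pow_le_etheta`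
with the shift as the intertwining contraction (`Vy.V_shift`, `Vy.norm_S_le`), nothing left abstract. [cite: Enflo2023, v2 p.4, eq. (9)] -/
theorem Vy.norm_inner_pow_le_etheta (T : H →L[ℂ] H) (hT : ‖T‖ < 1) {x₀ y : H} {ε : ℝ} {a : Vy.ℓ2}
    (h : IsMinimal (Vy.V T hT y) x₀ ε a) (hε : ε < ‖x₀‖) (j : ℕ) :
    ‖⟪x₀ - Vy.V T hT y a, (T ^ j) (Vy.V T hT y a)⟫_ℂ‖ ≤ (⟪x₀ - Vy.V T hT y a, Vy.V T hT y a⟫_ℂ).re :=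
  Literature.Analysis.OperatorTheory.Enflo2023.norm_inner_pow_le_etheta h hε Vy.S Vy.norm_S_le T
    (Vy.V_shift T hT y) j

/-- The summable-increments form of the missing input (census R3) on the paper's objects: summable MC steps
`Σ‖V_{y'_{n+1}}a_{n+1} − V_{y'_n}a_n‖ < ∞` ⇒ norm convergence ⇒ (11) ⇒ NIS. [cite: Enflo2023, v2 (1), (2), (9), (11)] -/
theorem hasNontrivialClosedInvariantSubspace_of_minimal_vectors_summable (T : H →L[ℂ] H) (hT : ‖T‖ < 1)
    (x₀ : H) (hx₀ : ‖x₀‖ = 1) (y : ℕ → H) (ε : ℕ → ℝ) (hε : ∀ n, (0.3 : ℝ) ≤ ε n ∧ ε n ≤ 0.7)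
    (a : ℕ → Vy.ℓ2) (hmin : ∀ n, IsMinimal (Vy.V T hT (y n)) x₀ (ε n) (a n))
    (hεθ : Tendsto (fun n => (⟪x₀ - Vy.V T hT (y n) (a n), Vy.V T hT (y n) (a n)⟫_ℂ).re) atTop (𝓝 0))
    (hsum : Summable fun n => ‖Vy.V T hT (y (n + 1)) (a (n + 1)) - Vy.V T hT (y n) (a n)‖) :
    HasNontrivialClosedInvariantSubspace T :=
  hasNontrivialClosedInvariantSubspace_of_minimal_sequence_summable T x₀ hx₀ (fun n => Vy.V T hT (y n)) Vy.S
    Vy.norm_S_le (fun n b => Vy.V_shift T hT (y n) b) ε hε a hmin hεθ hsum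

/-- **Arbitrary operator norm** (the `‖T‖ < 1` WLOG made explicit on the paper's objects): for ANY bounded `T`, if
for some `c ≠ 0` with `‖c • T‖ < 1` the Main Construction run for `c • T` has `(εθ)_n → 0` and norm-convergent
outputs, then `T` itself has a non-trivial closed invariant subspace. [cite: Enflo2023, v2 p.2, (1), (9), (11)] -/
theorem hasNontrivialClosedInvariantSubspace_of_minimal_vectors_smul (T : H →L[ℂ] H) {c : ℂ} (hc : c ≠ 0)
    (hcT : ‖c • T‖ < 1) (x₀ : H) (hx₀ : ‖x₀‖ = 1) (y : ℕ → H)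
    (ε : ℕ → ℝ) (hε : ∀ n, (0.3 : ℝ) ≤ ε n ∧ ε n ≤ 0.7)
    (a : ℕ → Vy.ℓ2) (hmin : ∀ n, IsMinimal (Vy.V (c • T) hcT (y n)) x₀ (ε n) (a n))
    (hεθ : Tendsto (fun n => (⟪x₀ - Vy.V (c • T) hcT (y n) (a n), Vy.V (c • T) hcT (y n) (a n)⟫_ℂ).re)
      atTop (𝓝 0))
    (w : H) (hconv : Tendsto (fun n => Vy.V (c • T) hcT (y n) (a n)) atTop (𝓝 w)) :
    HasNontrivialClosedInvariantSubspace T :=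
  (hasNontrivialClosedInvariantSubspace_smul_iff T hc).1
    (hasNontrivialClosedInvariantSubspace_of_minimal_vectors (c • T) hcT x₀ hx₀ y ε hε a hmin hεθ w hconv)

end data

end Literature.Analysis.OperatorTheory.Enflo2023
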